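import Summits.QuantumFields.BalabanUV.T4Continuum.Support.B13TermHistSecant
import Summits.QuantumFields.BalabanUV.T4Continuum.Support.B13BaseInsDatum

/-!
# NE5 ∕ U3 — the SECANT END FACE applied to the ASSEMBLED step model (`B13Represents.Assembly.step`), with the HISTORY HALF OF
# W2 PRODUCED at activity level (`B13TermHistSecant.histSecant_step_of_act`): L01∕L02∕L03, L08r, d3, the history species'
# class membership and modulus DISCHARGED by construction ∕ from per-activity data; the remaining binders DISPLAYED by name —
# conclusion literally `T4OutputRate.NE5 outA outB W κ θ′ C₅` (the swarm's census of what remains on the assembled model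
# ALONG THE REACH-FREE SECANT ROUTE of `T4InputCauchyRateSecant`)

Cell `pub-balaban`, unit `b2b-balaban-t4-ne5-formalise-leaf-03` (NE5 formalisation swarm, LEAF PROVER 03, gen 2; O2-hist INTENT
`CLAIMS.log` l.6438; the secant twin of leaf-09's `B13StepEnd` p208726).  Summits-side new work under the LEAN PLACEMENT RULE (cell
bookkeeping; NOT a Literature module; NO owner END-face module is edited — a NEW module applying the landed END face
`T4InputCauchyRateSecant.ne5_at_of_stepModel_secant_scale_nat` BY NAME).  HONEST FRAMING: rung (B)+1 of the FINITE-VOLUME T⁴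
continuum programme — NOT infinite volume, NOT a mass gap, NOT the Clay problem, and **NOT A PROOF OF NE5**: the theorem below is an
IMPLICATION whose wall binders (W2-op = `OpLipschitz`, cell GAPS G-ne5p1-1′, NOT PRINTED; the per-activity absolute majorants ∕
exponent bounds ∕ per-domain budgets of the (2.14)-terms — (2.15)∕(2.38), (2.18)∕(2.20), (2.41)∕[26] KIND, NOT PRINTED as class
statements; W1 in row NE2's entry currency — NOT PRINTED; W4; the one-run slice budgets — W3 KIND; the one-run levels L05∕L06 —
quoted SHAPES of [Balaban1987RG1] (1.18) p. 263; the numerics) are DISPLAYED HYPOTHESES, asserted nowhere.  HONEST DEPENDENCY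
(cell line, verbatim): continuum YM on T⁴ ⇐ BetaPertH ∧ nine spine estimates (0/9 proved); BetaPertH ⇐ (D1) ∧ (D4) ∧ CAP+tail;
G-an2-4 gates asym, D1 and NE2/3/4.

WHAT THIS FILE DOES.  `T4InputCauchyRateSecant.ne5_at_of_stepModel_secant_scale_nat` (owner lineage, p191857) is applied to
`M := 𝔄.step (𝔄.bHist E₀ cB)` with
* `hrA`, `hrB`, `hbase` := `Assembly.representsA hT` ∕ `representsB` ∕ `inBase` (L01 under the transport READING, L02, L03);
* `hsec` := **`B13TermHistSecant.histSecant_step_of_act`** — the class-wide history modulus `2G₁` on the budget ball class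
  `ballClass (selfCtr raw histRef) ROp RHist` PRODUCED from leaf-08's structure `ActExpLinearOn`, the per-activity DISPLAYED binders
  `ActExpNormBound` ∕ `ActAbsBound`, d3's convergence binder and the per-domain first-moment budget (NO analyticity, NO reach, NO
  room in the history species);
* `hpair` := `histPairInClass_ballClass` from L03, `Assembly.baseBudget`, and **`histBudgetA`** (§1: run A's history budget about
  the class centre = `B13BaseInsDatum.histBudgetA_of_insDatum` with the base-part discrepancy `β k = δ′·rHist k` READ OFF W4 AT THE
  ZERO TABLE — `norm_baseA_sub_histRef_le`, no new binder), the operator rate, and the RADII conditions `(c₁∕r₀)·rOp ≤ ROp`,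
  `bHist ≤ RHist`, `δ′·rHist + EA₀·rHist·cA∕(1 − ω) ≤ RHist` — the two runs' BUDGETS themselves, no margin added;
* `hop` := `Assembly.operatorRate_of_weightedEntrywise` (W1 from row NE2's entry-currency object, displayed), `hins` (W4, displayed),
  `haff`∕`hblind`∕`hhom` by construction, `hunit` := `Assembly.insScaleBound` (A-side slice budget, displayed), `hopL` (W2-op,
  displayed), levels `hdA`∕`hdB`, numerics (`hreach : (c₁∕r₀)·θ^{k₀} ≤ ρ₀` — operator species ONLY, `hfirst`, `hsmall : ω + 2G₁·cA < θ′`).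
Conclusion: `NE5 outA outB W κ θ′ ((Λop·(c₁∕r₀) + 2G₁·δ′ + B)(θ′ − ω)∕(θ′ − (ω + 2G₁·cA)))`.  Value: the binder list of
`ne5_of_assembly_secant` IS the census of what remains for NE5 on the assembled model along the secant route — compared with the
Cauchy-faced `B13StepEnd.ne5_of_assembly`: GONE the history reach `cA(EA₀+E₀)∕(1−ω)` in `hnear`, the room `bHist + rHist ≤ RHist`,
`TermLineAnalytic` and the X-blind `TermBound`∕`TermBudget`; NEW the per-activity exponent bounds and absolute majorants, the
per-domain first-moment budget, `OpLipschitz` as the operator half, and run A's budget radius.  0 sorry; no new axioms.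
-/

noncomputable section

open scoped BigOperators
open Metric Set

namespace Summit.QuantumFields.BalabanUV.T4Continuum.B13StepSecantEnd

open Literature.MathematicalPhysics.QuantumFieldTheory.Balaban1983to89.T4OutputRate (Carriers Functional DecayBound NE5)
open Literature.MathematicalPhysics.QuantumFieldTheory.Balaban1983to89.T4InputCauchyRateData (StepModel)
open Literature.MathematicalPhysics.QuantumFieldTheory.Balaban1983to89.T4InputCauchyRateSpecies (ballClass BaseBudget OpLipschitz)
open Literature.MathematicalPhysics.QuantumFieldTheory.Balaban1983to89.T4InputCauchyRateSecant
  (HistSecant HistBudgetA HistPairInClass histPairInClass_ballClass ne5_at_of_stepModel_secant_scale_nat)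
open Summit.QuantumFields.BalabanUV.T4Continuum.B13OpDatum (OpDatum)
open Summit.QuantumFields.BalabanUV.T4Continuum.B13OpDatumJunctions (RawBounded WeightedEntrywiseRate)
open Summit.QuantumFields.BalabanUV.T4Continuum.B13HistInsertion (InsDatum)
open Summit.QuantumFields.BalabanUV.T4Continuum.B13StepTermFamily (ActData ActExpLinearOn)
open Summit.QuantumFields.BalabanUV.T4Continuum.B13TermRep (actMajorant)
open Summit.QuantumFields.BalabanUV.T4Continuum.B13Base (selfCtr)
open Summit.QuantumFields.BalabanUV.T4Continuum.B13BaseInsDatum (baseA histBudgetA_of_insDatum)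
open Summit.QuantumFields.BalabanUV.T4Continuum.B13Represents (Assembly)
open Summit.QuantumFields.BalabanUV.T4Continuum.B13TermHistSecant (ActExpNormBound ActAbsBound secMajorant histSecant_step_of_act)

variable {C : Carriers} {E IOp Hist ι P J Ω : Type*} [NormedAddCommGroup Hist] [NormedSpace ℂ Hist] [MeasurableSpace Ω]
  (𝔄 : Assembly C E IOp Hist ι P J)

/-! ## §1 Run A's history budget about the class centre: the base-part discrepancy READ OFF W4 at the zero table -/

/-- [folklore] An `InsDatum`'s slices vanish on the zero table (ℝ-linearity). -/
theorem slice_zero (D : InsDatum C IOp Hist) (k j : ℕ) (a : IOp) : D.slice k j a 0 = 0 := by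
  have h := D.slice_smul k j a 0 0
  rwa [zero_smul, Complex.ofReal_zero, zero_smul] at h

/-- [folklore] … hence the insertion of the zero table is the base part. -/
theorem ins_zero (D : InsDatum C IOp Hist) (k : ℕ) (a : IOp) : D.ins k a 0 = D.base k a := by
  rw [InsDatum.ins]; simp [slice_zero]

/-- [folklore] **THE BASE-PART DISCREPANCY FROM W4**: the displayed insertion rate `InsertionRate W κ E₀ δ′ θ` of the assembled
model (with `0 ≤ E₀`, `0 ≤ δ′`, `0 ≤ θ ≤ 1`), read at the ZERO table, bounds the distance of run A's base part from the class
centre's history component (run B's base part): `‖baseA − histRef‖ ≤ δ′·rHist k` — no new binder. -/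
theorem norm_baseA_sub_histRef_le (BHist : ℕ → ℝ) {W : Set (ℕ → ℝ)} {κ E₀ δ' θ : ℝ}
    (hins : (𝔄.step BHist).InsertionRate W κ E₀ δ' θ) (hE₀ : 0 ≤ E₀) (hδ' : 0 ≤ δ') (hθ : 0 ≤ θ) (hθ1 : θ ≤ 1)
    (k : ℕ) {g : ℕ → ℝ} (hg : g ∈ W) (U : C.BgB) :
    ‖baseA 𝔄.D g U k - (selfCtr 𝔄.raw 𝔄.histRef k g U).2‖ ≤ δ' * 𝔄.rHist k := by
  have h := hins k g hg U 0 fun Y => by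
    rw [Pi.zero_apply, abs_zero]; exact mul_nonneg hE₀ (Real.exp_pos _).le
  have hA : (𝔄.step BHist).insA g U k 0 = baseA 𝔄.D g U k := ins_zero 𝔄.D k _
  have hB : (𝔄.step BHist).insB g U k 0 = (selfCtr 𝔄.raw 𝔄.histRef k g U).2 := ins_zero 𝔄.D k _
  rw [hA, hB] at h
  refine h.trans ?_
  have hr := (𝔄.rHist_pos k).le
  calc δ' * θ ^ k * (𝔄.step BHist).rHist k ≤ δ' * 1 * 𝔄.rHist k :=
        mul_le_mul_of_nonneg_right (mul_le_mul_of_nonneg_left (pow_le_one₀ hθ hθ1) hδ') hr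
    _ = δ' * 𝔄.rHist k := by ring

/-- [folklore] **RUN A's HISTORY BUDGET ABOUT THE CENTRE** for the assembled model: the reading `ReadsA` (by construction), the
DISPLAYED A-side slice budget `SliceBudget κ cA` (W3 KIND), the quoted level `DecayBound outA W EA₀ κ` (L05) and W4 at the zero table
⟹ `HistBudgetA M (selfCtr raw histRef) EA W (k ↦ δ′·rHist k + EA₀·rHist k·cA∕(1 − ω))` (`B13BaseInsDatum.histBudgetA_of_insDatum`). -/
theorem histBudgetA (BHist : ℕ → ℝ) {W : Set (ℕ → ℝ)} {EA : Functional C C.BgA} {κ EA₀ E₀ cA δ' θ : ℝ}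
    (hbA : 𝔄.D.SliceBudget (𝔄.step BHist) W κ cA) (hdA : DecayBound EA W EA₀ κ)
    (hins : (𝔄.step BHist).InsertionRate W κ E₀ δ' θ) (hEA₀ : 0 ≤ EA₀) (hE₀ : 0 ≤ E₀) (hcA : 0 ≤ cA) (hδ' : 0 ≤ δ')
    (hθ : 0 ≤ θ) (hθ1 : θ ≤ 1) (hω : 0 ≤ 𝔄.D.ω) (hω1 : 𝔄.D.ω < 1) :
    HistBudgetA (𝔄.step BHist) (selfCtr 𝔄.raw 𝔄.histRef) EA W
      fun k => δ' * 𝔄.rHist k + EA₀ * (𝔄.rHist k * (cA / (1 - 𝔄.D.ω))) :=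
  histBudgetA_of_insDatum (𝔄.readsA BHist W) hbA hdA hEA₀ hcA hω hω1
    fun k _ hg U => norm_baseA_sub_histRef_le 𝔄 BHist hins hE₀ hδ' hθ hθ1 k hg U

/-! ## §2 The secant END face on the assembled model -/

/-- [folklore] **THE SECANT END FACE ON THE ASSEMBLED STEP MODEL.**  For `𝔄.step (𝔄.bHist E₀ cB)` with its recursively defined
outputs `outA`∕`outB`: the transport READING; the DISPLAYED one-run slice budgets of both runs (W3 KIND); the quoted levels L05∕L06;
the DISPLAYED weighted entrywise two-run species rate `c₁·θ^k` with bounded raw suppliers and margin floor `r₀` (W1, row NE2's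
currency); the DISPLAYED insertion rate `δ′` (W4); the DISPLAYED operator-species two-point modulus `OpLipschitz κ Λop ρ₀` (W2-op,
wall); leaf-08's STRUCTURE `ActExpLinearOn` of the (2.14)-terms and the DISPLAYED per-activity exponent bounds (`N ≥ 0`, history
margins) ∕ absolute majorants `A` ∕ d3's convergence binder ∕ per-domain first-moment budget `G₁` on the budget ball class
`ballClass (selfCtr raw histRef) ROp RHist`; the RADII `(c₁∕r₀)·rOp ≤ ROp`, `bHist E₀ cB ≤ RHist`,
`δ′·rHist + EA₀·rHist·cA∕(1 − ω) ≤ RHist` (the budgets themselves — no room); and the numerics (operator reach `(c₁∕r₀)·θ^{k₀} ≤ ρ₀`,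
first scales `B`, smallness `ω + 2G₁·cA < θ′`) IMPLY `NE5 outA outB W κ θ′ ((Λop·(c₁∕r₀) + 2G₁·δ′ + B)(θ′ − ω)∕(θ′ − (ω + 2G₁·cA)))`.
MI-R, L03, L08r, d3, `HistSecant`, `HistPairInClass`∕`HistBudgetA` are DISCHARGED inside.  NOT a proof of NE5: an implication from
displayed binders. -/
theorem ne5_of_assembly_secant {W : Set (ℕ → ℝ)} {ROp RHist : ℕ → ℝ} {N A : ℕ → (ℕ → ℝ) → C.BgB → P → J → ℝ}
    {Dt : ActData P J (OpDatum E) Hist Ω} {κ Λop G₁ EA₀ E₀ E₁ cA cB c₁ r₀ δ' θ θ' ρ₀ B : ℝ} {k₀ : ℕ}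
    (hT : 𝔄.TransportReads W)
    (hbB : 𝔄.SliceBudgetB W κ cB) (hbA : 𝔄.D.SliceBudget (𝔄.step (𝔄.bHist E₀ cB)) W κ cA)
    (hdA : DecayBound (𝔄.outA (𝔄.bHist E₀ cB)) W EA₀ κ) (hdB : DecayBound (𝔄.outB (𝔄.bHist E₀ cB)) W E₀ κ)
    (hRA : RawBounded 𝔄.F 𝔄.rawAt W) (hRB : RawBounded 𝔄.F 𝔄.rawB W)
    (hwer : WeightedEntrywiseRate 𝔄.F 𝔄.rawAt 𝔄.rawB W c₁ fun k => θ ^ k) (hfl : ∀ k, r₀ ≤ 𝔄.rOp k)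
    (hins : (𝔄.step (𝔄.bHist E₀ cB)).InsertionRate W κ E₀ δ' θ)
    (hopL : OpLipschitz (𝔄.step (𝔄.bHist E₀ cB)) W κ Λop ρ₀)
    (hexp : ActExpLinearOn 𝔄.𝒯 𝔄.act Dt (ballClass (selfCtr 𝔄.raw 𝔄.histRef) ROp RHist) W)
    (hN : ActExpNormBound 𝔄.𝒯 Dt (ballClass (selfCtr 𝔄.raw 𝔄.histRef) ROp RHist) W 𝔄.rHist N)
    (hN0 : ∀ k g U Z j, 0 ≤ N k g U Z j)
    (habs : ActAbsBound 𝔄.𝒯 Dt (ballClass (selfCtr 𝔄.raw 𝔄.histRef) ROp RHist) W A)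
    (hconv : ∀ k, ∀ g ∈ W, ∀ (U : C.BgB) (X : C.Dom), C.scale X = k → Summable (actMajorant 𝔄.𝒯 𝔄.inc (A k g U) k X))
    (hmom : ∀ k, ∀ g ∈ W, ∀ (U : C.BgB) (X : C.Dom), C.scale X = k →
      Summable (secMajorant 𝔄.𝒯 𝔄.inc (N k g U) (A k g U) k X) ∧
        ∑' i, secMajorant 𝔄.𝒯 𝔄.inc (N k g U) (A k g U) k X i ≤ G₁ * Real.exp (-(κ * C.d X)))
    (hOp : ∀ k, c₁ / r₀ * 𝔄.rOp k ≤ ROp k) (hHist : ∀ k, 𝔄.bHist E₀ cB k ≤ RHist k)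
    (hHistA : ∀ k, δ' * 𝔄.rHist k + EA₀ * (𝔄.rHist k * (cA / (1 - 𝔄.D.ω))) ≤ RHist k)
    (hEA₀ : 0 ≤ EA₀) (hE₀ : 0 ≤ E₀) (hE₁ : 0 < E₁) (hΛop : 0 ≤ Λop) (hG₁ : 0 ≤ G₁) (hcA : 0 ≤ cA) (hcB : 0 ≤ cB)
    (hc₁ : 0 ≤ c₁) (hr₀ : 0 < r₀) (hδ' : 0 ≤ δ') (hθ : 0 ≤ θ) (hθθ' : θ ≤ θ') (hθ'1 : θ' ≤ 1) (hω : 0 < 𝔄.D.ω)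
    (hω1 : 𝔄.D.ω < 1) (hreach : c₁ / r₀ * θ ^ k₀ ≤ ρ₀) (hB : 0 ≤ B) (hfirst : ∀ k < k₀, EA₀ + E₀ ≤ B * θ ^ k)
    (hsmall : 𝔄.D.ω + 2 * G₁ * cA < θ') :
    NE5 (𝔄.outA (𝔄.bHist E₀ cB)) (𝔄.outB (𝔄.bHist E₀ cB)) W κ θ'
      ((Λop * (c₁ / r₀) + 2 * G₁ * δ' + B) * (θ' - 𝔄.D.ω) / (θ' - (𝔄.D.ω + 2 * G₁ * cA))) := by
  have hbase := Assembly.inBase (𝔄 := 𝔄) hbB hdB hE₀ hcB hω.le hω1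
  have hop := Assembly.operatorRate_of_weightedEntrywise (𝔄 := 𝔄) (BHist := 𝔄.bHist E₀ cB) hRA hRB hwer hc₁ hθ hfl hr₀
  have hpair : HistPairInClass (𝔄.step (𝔄.bHist E₀ cB)) (ballClass (selfCtr 𝔄.raw 𝔄.histRef) ROp RHist)
      (𝔄.outA (𝔄.bHist E₀ cB)) (𝔄.outB (𝔄.bHist E₀ cB)) W :=
    histPairInClass_ballClass hbase (𝔄.baseBudget _ W)
      (histBudgetA 𝔄 _ hbA hdA hins hEA₀ hE₀ hcA hδ' hθ (hθθ'.trans hθ'1) hω.le hω1) hop (div_nonneg hc₁ hr₀.le) hθ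
      (hθθ'.trans hθ'1) (fun k => by rw [Pi.zero_apply, zero_add]; exact hOp k) hHist hHistA
  exact ne5_at_of_stepModel_secant_scale_nat (𝔄.step (𝔄.bHist E₀ cB)) (𝔄.representsA _ hT) (𝔄.representsB _ W) hbase hpair
    hopL (histSecant_step_of_act 𝔄 _ hexp hN habs hN0 hconv hmom) hdA hdB hop hins (𝔄.insAffine _ W) (𝔄.insBlind _ W)
    (𝔄.insHomog _ W) (Assembly.insScaleBound hbA hω.le hE₁.le) hE₁ hΛop (by positivity) (div_nonneg hc₁ hr₀.le) hδ' hθ hθθ'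
    hθ'1 hcA hω hreach hB hfirst hsmall

end Summit.QuantumFields.BalabanUV.T4Continuum.B13StepSecantEnd

end
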